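import Mathlib
import Summits.CriticalPhenomena.Ising3DConformalLimit.Theorems.PrecisionLaplacianPrecisionIsLaplacianRows
import HarnessLib

/-!
# The precision operator is a Laplacian — abstract `ℓ¹` part, II: no defect and conservativity

Helper file for route `PrecisionLaplacian`, item `PrecisionIsLaplacian` (stmt-CriticalPhenomena-4803)
of `CriticalPhenomena/Ising3DConformalLimit`; continuation of
`PrecisionLaplacianPrecisionIsLaplacianRows.lean` (same hypotheses, see the module docstring there).

Here: the lower ("no defect") half of the convolution identity
`Σ_y m(y) G(z−y) = −δ_{z0}` by an `ε` / finite-set split that uses only the uniform mass bound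
`Σ_{y≠0} −r A y ≤ r A 0` and `G → 0` at infinity; conservativity `Σ_y m(y) = 0`: if the killing
rate `κ = A₀ − Σ_{y≠0} m(y)` were positive, summing the identity over a translate `Λ + x` of a
finite set and taking the supremum over `x` gives `κ · sup_x Σ_{Λ+x} G ≤ 1`, so `G` would be
summable — contradicting `Σ G = ∞` (`χ(β_c) = ∞`); and the packaged statement `pil_abstract`.
No Fourier analysis is used.
-/

namespace Summit.CriticalPhenomena.Ising3DConformalLimit.Theorems

open Filter Topology Finset Function
open Literature.Probability.LatticeModels (Site)

section Abstract

variable {G : Site 3 → ℝ} {r : Finset (Site 3) → Site 3 → ℝ} {m mp : Site 3 → ℝ} {D : ℝ}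

/-- Lower half of the convolution identity (no defect at infinity):
`A₀ G z − δ_{z0} ≤ Σ'_y mp y · G(z−y)`. The proof is an `ε` / finite-set split: far from `z`
the weights `G(z−y)` are `< η` against total mass `≤ max D 0`; near `z` (a finite set `F`) the
finitely many `−r A y` are within `η / (|F|+1)` of their infima for `A` large. -/
theorem pil_le_tsum_mp_mul (hG0 : ∀ x, 0 ≤ G x) (hGb : ∀ x, G x ≤ G 0)
    (hGlim : Tendsto G cofinite (𝓝 0))
    (hrZ : ∀ A y, y ≠ 0 → r A y ≤ 0)
    (hrsum : ∀ A, (0 : Site 3) ∈ A → 0 ≤ ∑ y ∈ A, r A y)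
    (hrid : ∀ A, (0 : Site 3) ∈ A → ∀ z ∈ A,
      ∑ y ∈ A, r A y * G (z - y) = if z = 0 then 1 else 0)
    (hrmono : ∀ A A', (0 : Site 3) ∈ A → A ⊆ A' → ∀ y ∈ A, r A y ≤ r A' y)
    (hrD : ∀ A, (0 : Site 3) ∈ A → r A 0 ≤ D)
    (hm : ∀ y, m y = ⨅ A : {A : Finset (Site 3) // (0 : Site 3) ∈ A ∧ y ∈ A}, -r A.1 y)
    (hmp : ∀ y, mp y = if y = 0 then 0 else m y) (z : Site 3) :
    -m 0 * G z - (if z = 0 then 1 else 0) ≤ ∑' y, mp y * G (z - y) := by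
  have hsP := pil_summable_mp_mul hG0 hGb hrZ hrsum hrD hm hmp z
  have hG00 : 0 < G 0 := pil_G_zero_pos hG0 hrZ hrid
  have hD0 : (0 : ℝ) ≤ max D 0 := le_max_right _ _
  refine le_of_forall_pos_le_add fun ε hε => ?_
  -- tolerance `η` with `η · (2 G 0 + max D 0) ≤ ε`
  obtain ⟨η, hη0, hηε⟩ : ∃ η : ℝ, 0 < η ∧ η * (2 * G 0 + max D 0) ≤ ε := by
    refine ⟨ε / (2 * G 0 + max D 0 + 1), div_pos hε (by positivity), ?_⟩
    rw [div_mul_eq_mul_div, div_le_iff₀ (by positivity)]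
    nlinarith
  -- the finite set `F` of `y` with `G (z - y) ≥ η`
  have hGz : Tendsto (fun y => G (z - y)) cofinite (𝓝 0) :=
    hGlim.comp sub_right_injective.tendsto_cofinite
  have hfin : {y : Site 3 | ¬ (G (z - y) < η)}.Finite :=
    Filter.eventually_cofinite.1 (hGz.eventually (gt_mem_nhds hη0))
  set F := hfin.toFinset with hF
  have hFmem : ∀ y, y ∉ F → G (z - y) < η := by
    intro y hy
    by_contra h
    exact hy (hfin.mem_toFinset.2 h)
  -- second tolerance `η' = η / (|F| + 1)`
  set η' : ℝ := η / (F.card + 1) with hη'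
  have hη'0 : 0 < η' := div_pos hη0 (by positivity)
  have hη'F : (F.card : ℝ) * η' ≤ η := by
    calc (F.card : ℝ) * η' = η * (F.card / (F.card + 1)) := by rw [hη']; ring
      _ ≤ η * 1 :=
          mul_le_mul_of_nonneg_left ((div_le_one (by positivity)).2 (by linarith)) hη0.le
      _ = η := mul_one η
  have hη'η : η' ≤ η :=
    div_le_self hη0.le (by linarith [(Nat.cast_nonneg F.card : (0 : ℝ) ≤ F.card)])
  -- thresholds from the monotone limit, and the finite set `A`
  choose T hT using fun y => pil_exists_lt hrmono hm y hη'0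
  set A := insert z ((insert (0 : Site 3) F).biUnion T) with hA
  have hTA : ∀ y ∈ insert (0 : Site 3) F, T y ⊆ A := fun y hy =>
    (Finset.subset_biUnion_of_mem T hy).trans (Finset.subset_insert _ _)
  have h0A : (0 : Site 3) ∈ A := hTA 0 (Finset.mem_insert_self _ _) (hT 0).1
  have hzA : z ∈ A := Finset.mem_insert_self _ _
  -- the row identity with the origin term split off
  have hid := hrid A h0A z hzA
  rw [← Finset.add_sum_erase A _ h0A, sub_zero] at hid
  set E := A.erase 0 with hE
  -- `r A 0` is within `η'` of `A₀ = −m 0`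
  have hr0 : -m 0 - η' ≤ r A 0 := by
    have := (hT 0).2.2 A (hTA 0 (Finset.mem_insert_self _ _))
    linarith
  -- total mass off the origin
  have hmass : ∑ y ∈ E, -r A y ≤ max D 0 := by
    have h1 := hrsum A h0A
    rw [← Finset.add_sum_erase A _ h0A] at h1
    have h2 := hrD A h0A
    have h3 : D ≤ max D 0 := le_max_left _ _
    rw [Finset.sum_neg_distrib]
    linarith
  -- split `E` along `F`
  have hsplit := Finset.sum_filter_add_sum_filter_not E (fun y => y ∈ F)
    (fun y => -r A y * G (z - y))
  -- far part
  have hfar : ∑ y ∈ E.filter (fun y => y ∉ F), -r A y * G (z - y) ≤ η * max D 0 := by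
    calc ∑ y ∈ E.filter (fun y => y ∉ F), -r A y * G (z - y)
        ≤ ∑ y ∈ E.filter (fun y => y ∉ F), η * (-r A y) := by
          refine Finset.sum_le_sum fun y hy => ?_
          have hy' := Finset.mem_filter.1 hy
          have hrnn : 0 ≤ -r A y := by
            have := hrZ A y (Finset.ne_of_mem_erase hy'.1)
            linarith
          rw [mul_comm η]
          exact mul_le_mul_of_nonneg_left (hFmem y hy'.2).le hrnn
      _ = η * ∑ y ∈ E.filter (fun y => y ∉ F), -r A y := by rw [Finset.mul_sum]
      _ ≤ η * ∑ y ∈ E, -r A y := by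
          refine mul_le_mul_of_nonneg_left ?_ hη0.le
          refine Finset.sum_le_sum_of_subset_of_nonneg (Finset.filter_subset _ _)
            fun y hy _ => ?_
          have := hrZ A y (Finset.ne_of_mem_erase hy)
          linarith
      _ ≤ η * max D 0 := mul_le_mul_of_nonneg_left hmass hη0.le
  -- near part
  have hnear : ∑ y ∈ E.filter (fun y => y ∈ F), -r A y * G (z - y)
      ≤ (∑' y, mp y * G (z - y)) + η * G 0 := by
    calc ∑ y ∈ E.filter (fun y => y ∈ F), -r A y * G (z - y)
        ≤ ∑ y ∈ E.filter (fun y => y ∈ F), (mp y * G (z - y) + η' * G 0) := by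
          refine Finset.sum_le_sum fun y hy => ?_
          have hy' := Finset.mem_filter.1 hy
          have hy0 : y ≠ 0 := Finset.ne_of_mem_erase hy'.1
          have hyF : y ∈ insert (0 : Site 3) F := Finset.mem_insert_of_mem hy'.2
          have hlt := (hT y).2.2 A (hTA y hyF)
          have hmpy : mp y = m y := by rw [hmp y, if_neg hy0]
          have h1 : -r A y * G (z - y) ≤ (mp y + η') * G (z - y) :=
            mul_le_mul_of_nonneg_right (by rw [hmpy]; exact hlt.le) (hG0 _)
          have h2 : η' * G (z - y) ≤ η' * G 0 := mul_le_mul_of_nonneg_left (hGb _) hη'0.le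
          nlinarith
      _ = ∑ y ∈ E.filter (fun y => y ∈ F), mp y * G (z - y)
            + (E.filter (fun y => y ∈ F)).card • (η' * G 0) := by
          rw [Finset.sum_add_distrib, Finset.sum_const]
      _ ≤ (∑' y, mp y * G (z - y)) + F.card * (η' * G 0) := by
          refine add_le_add (hsP.sum_le_tsum _ fun y _ =>
            mul_nonneg (pil_mp_nonneg hrZ hm hmp y) (hG0 _)) ?_
          rw [nsmul_eq_mul]
          refine mul_le_mul_of_nonneg_right ?_ (mul_nonneg hη'0.le hG00.le)
          exact_mod_cast Finset.card_le_card (fun y hy => (Finset.mem_filter.1 hy).2)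
      _ ≤ (∑' y, mp y * G (z - y)) + η * G 0 := by nlinarith [hη'F, hG00.le]
  -- assemble
  have hEsum : ∑ y ∈ E, r A y * G (z - y) = -(∑ y ∈ E, -r A y * G (z - y)) := by
    rw [← Finset.sum_neg_distrib]
    exact Finset.sum_congr rfl fun y _ => by ring
  have hprod1 : (-m 0 - η') * G z ≤ r A 0 * G z := mul_le_mul_of_nonneg_right hr0 (hG0 z)
  have hprod2 : η' * G z ≤ η * G 0 := mul_le_mul hη'η (hGb z) (hG0 z) hη0.le
  nlinarith [hsplit, hfar, hnear, hid, hEsum, hprod1, hprod2, hηε]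

/-- The convolution identity for `mp`: `Σ'_y mp y · G(z−y) = A₀ G z − δ_{z0}`. -/
theorem pil_tsum_mp_mul_eq (hG0 : ∀ x, 0 ≤ G x) (hGb : ∀ x, G x ≤ G 0)
    (hGlim : Tendsto G cofinite (𝓝 0))
    (hrZ : ∀ A y, y ≠ 0 → r A y ≤ 0)
    (hrsum : ∀ A, (0 : Site 3) ∈ A → 0 ≤ ∑ y ∈ A, r A y)
    (hrid : ∀ A, (0 : Site 3) ∈ A → ∀ z ∈ A,
      ∑ y ∈ A, r A y * G (z - y) = if z = 0 then 1 else 0)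
    (hrmono : ∀ A A', (0 : Site 3) ∈ A → A ⊆ A' → ∀ y ∈ A, r A y ≤ r A' y)
    (hrD : ∀ A, (0 : Site 3) ∈ A → r A 0 ≤ D)
    (hm : ∀ y, m y = ⨅ A : {A : Finset (Site 3) // (0 : Site 3) ∈ A ∧ y ∈ A}, -r A.1 y)
    (hmp : ∀ y, mp y = if y = 0 then 0 else m y) (z : Site 3) :
    ∑' y, mp y * G (z - y) = -m 0 * G z - (if z = 0 then 1 else 0) :=
  le_antisymm (pil_tsum_mp_mul_le hG0 hrZ hrid hrD hm hmp z)
    (pil_le_tsum_mp_mul hG0 hGb hGlim hrZ hrsum hrid hrmono hrD hm hmp z)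

/-- **Conservativity** (`κ = 0`): `Σ'_{y} mp y = A₀ = −m 0`. If `κ = A₀ − Σ' mp > 0`, summing the
convolution identity over a translate `Λ + x` of a finite set and taking the supremum over `x`
gives `κ · sup_x Σ_{w ∈ Λ} G(w + x) ≤ 1`, whence `G` is summable — contradicting `Σ G = ∞`. -/
theorem pil_tsum_mp_eq (hG0 : ∀ x, 0 ≤ G x) (hGb : ∀ x, G x ≤ G 0)
    (hGlim : Tendsto G cofinite (𝓝 0)) (hGns : ¬ Summable G)
    (hrZ : ∀ A y, y ≠ 0 → r A y ≤ 0)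
    (hrsum : ∀ A, (0 : Site 3) ∈ A → 0 ≤ ∑ y ∈ A, r A y)
    (hrid : ∀ A, (0 : Site 3) ∈ A → ∀ z ∈ A,
      ∑ y ∈ A, r A y * G (z - y) = if z = 0 then 1 else 0)
    (hrmono : ∀ A A', (0 : Site 3) ∈ A → A ⊆ A' → ∀ y ∈ A, r A y ≤ r A' y)
    (hrD : ∀ A, (0 : Site 3) ∈ A → r A 0 ≤ D)
    (hm : ∀ y, m y = ⨅ A : {A : Finset (Site 3) // (0 : Site 3) ∈ A ∧ y ∈ A}, -r A.1 y)
    (hmp : ∀ y, mp y = if y = 0 then 0 else m y) : ∑' y, mp y = -m 0 := by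
  have hs := pil_summable_mp hrZ hrsum hrD hm hmp
  have hA0 : 0 < -m 0 := by
    have := pil_m_zero_neg hG0 hrZ hrid hrD hm
    linarith
  refine le_antisymm (pil_tsum_mp_le hrZ hrsum hrD hm hmp) ?_
  by_contra hlt
  push Not at hlt
  set κ := -m 0 - ∑' y, mp y with hκ
  have hκ0 : 0 < κ := by linarith
  apply hGns
  refine summable_of_sum_le (c := 1 / κ) (fun x => hG0 x) fun Λ => ?_
  -- `M := sup_x Σ_{w ∈ Λ} G (w + x)`
  have hbdA : BddAbove (Set.range fun x : Site 3 => ∑ w ∈ Λ, G (w + x)) := by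
    refine ⟨Λ.card * G 0, ?_⟩
    rintro _ ⟨x, rfl⟩
    calc ∑ w ∈ Λ, G (w + x) ≤ ∑ w ∈ Λ, G 0 := Finset.sum_le_sum fun w _ => hGb _
      _ = Λ.card * G 0 := by rw [Finset.sum_const, nsmul_eq_mul]
  set M := ⨆ x : Site 3, ∑ w ∈ Λ, G (w + x) with hM
  have hSM : ∀ x, ∑ w ∈ Λ, G (w + x) ≤ M := fun x => le_ciSup hbdA x
  have key : ∀ x, -m 0 * ∑ w ∈ Λ, G (w + x) ≤ 1 + (∑' y, mp y) * M := by
    intro x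
    have hpt : ∀ w, -m 0 * G w = (if w = 0 then 1 else 0) + ∑' y, mp y * G (w - y) := by
      intro w
      have := pil_tsum_mp_mul_eq hG0 hGb hGlim hrZ hrsum hrid hrmono hrD hm hmp w
      linarith
    have hind : ∑ w ∈ Λ, (if w + x = 0 then (1 : ℝ) else 0) ≤ 1 := by
      have h1 : ∑ w ∈ Λ, (if w + x = 0 then (1 : ℝ) else 0)
          = ∑ w ∈ Λ, (if w = -x then (1 : ℝ) else 0) :=
        Finset.sum_congr rfl fun w _ => by simp only [add_eq_zero_iff_eq_neg]
      rw [h1, Finset.sum_ite_eq']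
      split_ifs <;> norm_num
    have hsw : ∀ w ∈ Λ, Summable fun y => mp y * G (w + x - y) := fun w _ =>
      pil_summable_mp_mul hG0 hGb hrZ hrsum hrD hm hmp (w + x)
    have hswap : ∑ w ∈ Λ, ∑' y, mp y * G (w + x - y) ≤ (∑' y, mp y) * M := by
      have h1 : ∑ w ∈ Λ, ∑' y, mp y * G (w + x - y) = ∑' y, ∑ w ∈ Λ, mp y * G (w + x - y) :=
        (Summable.tsum_finsetSum hsw).symm
      have h2 : (∑' y, mp y) * M = ∑' y, mp y * M := (hs.tsum_mul_right M).symm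
      rw [h1, h2]
      refine Summable.tsum_le_tsum (fun y => ?_) (summable_sum hsw) (hs.mul_right M)
      rw [← Finset.mul_sum]
      refine mul_le_mul_of_nonneg_left ?_ (pil_mp_nonneg hrZ hm hmp y)
      have h3 : ∑ w ∈ Λ, G (w + x - y) = ∑ w ∈ Λ, G (w + (x - y)) :=
        Finset.sum_congr rfl fun w _ => by rw [add_sub_assoc]
      rw [h3]
      exact hSM (x - y)
    calc -m 0 * ∑ w ∈ Λ, G (w + x)
        = ∑ w ∈ Λ, ((if w + x = 0 then (1 : ℝ) else 0) + ∑' y, mp y * G (w + x - y)) := by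
          rw [Finset.mul_sum]
          exact Finset.sum_congr rfl fun w _ => hpt (w + x)
      _ = ∑ w ∈ Λ, (if w + x = 0 then (1 : ℝ) else 0)
            + ∑ w ∈ Λ, ∑' y, mp y * G (w + x - y) := Finset.sum_add_distrib
      _ ≤ 1 + (∑' y, mp y) * M := add_le_add hind hswap
  -- supremum over `x`
  have hM1 : -m 0 * M ≤ 1 + (∑' y, mp y) * M := by
    have h1 : M ≤ (1 + (∑' y, mp y) * M) / (-m 0) := by
      refine ciSup_le fun x => ?_
      rw [le_div_iff₀ hA0, mul_comm]
      exact key x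
    rwa [le_div_iff₀ hA0, mul_comm] at h1
  have hκM : κ * M ≤ 1 := by
    rw [hκ, sub_mul]
    linarith
  calc ∑ w ∈ Λ, G w = ∑ w ∈ Λ, G (w + 0) := by simp
    _ ≤ M := hSM 0
    _ ≤ 1 / κ := by rw [le_div_iff₀ hκ0, mul_comm]; exact hκM

/-- `Σ'_y m y = 0`. -/
theorem pil_tsum_m_eq_zero (hG0 : ∀ x, 0 ≤ G x) (hGb : ∀ x, G x ≤ G 0)
    (hGlim : Tendsto G cofinite (𝓝 0)) (hGns : ¬ Summable G)
    (hrZ : ∀ A y, y ≠ 0 → r A y ≤ 0)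
    (hrsum : ∀ A, (0 : Site 3) ∈ A → 0 ≤ ∑ y ∈ A, r A y)
    (hrid : ∀ A, (0 : Site 3) ∈ A → ∀ z ∈ A,
      ∑ y ∈ A, r A y * G (z - y) = if z = 0 then 1 else 0)
    (hrmono : ∀ A A', (0 : Site 3) ∈ A → A ⊆ A' → ∀ y ∈ A, r A y ≤ r A' y)
    (hrD : ∀ A, (0 : Site 3) ∈ A → r A 0 ≤ D)
    (hm : ∀ y, m y = ⨅ A : {A : Finset (Site 3) // (0 : Site 3) ∈ A ∧ y ∈ A}, -r A.1 y)
    (hmp : ∀ y, mp y = if y = 0 then 0 else m y) : ∑' y, m y = 0 := by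
  rw [pil_tsum_m hrZ hrsum hrD hm hmp,
    pil_tsum_mp_eq hG0 hGb hGlim hGns hrZ hrsum hrid hrmono hrD hm hmp]
  ring

/-- The convolution identity for `m`: `Σ'_y m y · G(z − y) = −δ_{z0}`. -/
theorem pil_tsum_m_mul (hG0 : ∀ x, 0 ≤ G x) (hGb : ∀ x, G x ≤ G 0)
    (hGlim : Tendsto G cofinite (𝓝 0))
    (hrZ : ∀ A y, y ≠ 0 → r A y ≤ 0)
    (hrsum : ∀ A, (0 : Site 3) ∈ A → 0 ≤ ∑ y ∈ A, r A y)
    (hrid : ∀ A, (0 : Site 3) ∈ A → ∀ z ∈ A,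
      ∑ y ∈ A, r A y * G (z - y) = if z = 0 then 1 else 0)
    (hrmono : ∀ A A', (0 : Site 3) ∈ A → A ⊆ A' → ∀ y ∈ A, r A y ≤ r A' y)
    (hrD : ∀ A, (0 : Site 3) ∈ A → r A 0 ≤ D)
    (hm : ∀ y, m y = ⨅ A : {A : Finset (Site 3) // (0 : Site 3) ∈ A ∧ y ∈ A}, -r A.1 y)
    (hmp : ∀ y, mp y = if y = 0 then 0 else m y) (z : Site 3) :
    ∑' y, m y * G (z - y) = if z = 0 then -1 else 0 := by
  have hfun : (fun y => m y * G (z - y))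
      = Function.update (fun y => mp y * G (z - y)) 0 (m 0 * G z) := by
    funext y
    by_cases hy : y = 0
    · subst hy; simp
    · rw [Function.update_of_ne hy, hmp y, if_neg hy]
  have h := (pil_summable_mp_mul hG0 hGb hrZ hrsum hrD hm hmp z).hasSum.update 0 (m 0 * G z)
  rw [← hfun] at h
  rw [h.tsum_eq, pil_tsum_mp_mul_eq hG0 hGb hGlim hrZ hrsum hrid hrmono hrD hm hmp z]
  simp only [hmp 0, if_true, zero_mul, sub_zero]
  split_ifs <;> ring

/-- **Abstract form of `PrecisionIsLaplacian`.** Under the hypotheses of this section,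
`m y := inf_{A ∋ 0,y} −r A y` is summable, sums to `0`, is `≥ 0` off the origin and `< 0` at the
origin, and is minus the convolution inverse of `G`. -/
theorem pil_abstract (hG0 : ∀ x, 0 ≤ G x) (hGb : ∀ x, G x ≤ G 0)
    (hGlim : Tendsto G cofinite (𝓝 0)) (hGns : ¬ Summable G)
    (hrZ : ∀ A y, y ≠ 0 → r A y ≤ 0)
    (hrsum : ∀ A, (0 : Site 3) ∈ A → 0 ≤ ∑ y ∈ A, r A y)
    (hrid : ∀ A, (0 : Site 3) ∈ A → ∀ z ∈ A,
      ∑ y ∈ A, r A y * G (z - y) = if z = 0 then 1 else 0)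
    (hrmono : ∀ A A', (0 : Site 3) ∈ A → A ⊆ A' → ∀ y ∈ A, r A y ≤ r A' y)
    (hrD : ∀ A, (0 : Site 3) ∈ A → r A 0 ≤ D)
    (hm : ∀ y, m y = ⨅ A : {A : Finset (Site 3) // (0 : Site 3) ∈ A ∧ y ∈ A}, -r A.1 y) :
    Summable m ∧ ∑' y, m y = 0 ∧ (∀ y, y ≠ 0 → 0 ≤ m y) ∧ m 0 < 0 ∧
      ∀ z, ∑' y, m y * G (z - y) = if z = 0 then -1 else 0 := by
  have hmp : ∀ y, (fun y => if y = 0 then (0 : ℝ) else m y) y = if y = 0 then 0 else m y :=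
    fun y => rfl
  exact ⟨pil_summable_m hrZ hrsum hrD hm hmp,
    pil_tsum_m_eq_zero hG0 hGb hGlim hGns hrZ hrsum hrid hrmono hrD hm hmp,
    fun y hy => pil_m_nonneg hrZ hm hy, pil_m_zero_neg hG0 hrZ hrid hrD hm,
    fun z => pil_tsum_m_mul hG0 hGb hGlim hrZ hrsum hrid hrmono hrD hm hmp z⟩

end Abstract

end Summit.CriticalPhenomena.Ising3DConformalLimit.Theorems
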